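import Summits.BirchSwinnertonDyer.BirchSwinnertonDyer.Theorems.SignedBaseChangeAnticyclotomicEisensteinDivisibilityAdmdefUnrLineNonzero
import Summits.BirchSwinnertonDyer.BirchSwinnertonDyer.Theorems.AdditiveKolyvaginRoadToricFrobenius
import Summits.BirchSwinnertonDyer.BirchSwinnertonDyer.Theorems.AdditiveKolyvaginRoadLocalDictionaries
import Literature.NumberTheory.EllipticCurves.SelmerLocalConditionGoodReductionProofs
import Literature.NumberTheory.EllipticCurves.KummerSelmerStructure
import Literature.NumberTheory.EllipticCurves.GeomPointsGaloisModule
import HarnessLib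

/-!
# Line `admdef` (crux `AnticyclotomicEisensteinDivisibility`, stmt-BirchSwinnertonDyer-20727), rigidity road (M1): the LAYER-0 DICTIONARY between
# CHKLL25's bottom-layer classes `H¹(Γ_{K_0}, E[p])` with their `unramifiedAt` / `ordinaryAt` conditions and the tree's `H¹(K, E[p])`
# (`AdditiveKoly.Vp`) with `unramifiedKer`, the Kummer condition `selmerLocalKer`, the TORIC condition `toricLocalKer` and the genuine
# localisation `galoisCohomology.localization`

LEAD seat bsd-line-sbc-p1 (gen 28), `--supports stmt-BirchSwinnertonDyer-20727` (helper; OFF the v23 composition path; item (M1) «bottom-Selmer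
dictionary», sign-free part, of the rigidity road map `Lines/admdef-lead-g25.md` §4 / `…-g27.md` §3).  The transport is the restriction
`T = resH1Hom (Γ_{K_0} ↪ Γ_K, E[(p^1 : ℕ)] ↪ E[p^1])` of `…AdmdefCoreRootOfSeenAnchor` (§1, `res_layerZero_ne_zero`: injective), written out.

* §1 `resH1Hom_layerZero_oneCocycleClass` (T on an explicit cocycle), `exists_resH1Hom_layerZero_eq` (T is ONTO: `Γ_{K_0} = Γ_K`),
  `resOfLe_resH1Hom_layerZero_eq_zero_iff` (vanishing of `res_S ∘ T` on a cocycle: `∃ a, ψ|_S = ∂a`).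
* §2 UNRAMIFIED: `resH1Hom_layerZero_mem_unramifiedAt_iff` — `T X ∈ unramifiedAt 𝔓 ⟺ X ∈ unramifiedKer 𝔓` (both: `ψ|_{I_𝔓} = ∂a`); at a GOOD place
  `v ∤ p`: `⟺ X ∈ selmerLocalKer (K_v)` (the Kummer condition; Gross (7.1) = tree `selmerLocalKer_eq_unramifiedKer`), and
  `resOfLe_inertia_resH1Hom_layerZero_eq_zero_of_mem_unramifiedAt` (`⟹ res_{I_𝔓 ∩ Gal(K̄/K_∞)} (T X) = 0`, the ordinary coordinate vanishes).
* §3 LOCALLY TRIVIAL: `resOfLe_inertia_resH1Hom_layerZero_eq_zero_of_localization_eq_zero` — at a good `v ∤ p`, `loc_v X = 0 ⟹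
  res_{I_{𝔓₀} ∩ Gal(K̄/K_∞)} (T X) = 0` at the chosen prime `𝔓₀ = adicCompletionPrime K v` (`I_{𝔓₀} = res(I_{K_v})` fixes `E[p]`).
* §4 ORDINARY ⟹ TORIC at an admissible prime: `isArithFrobAt_mul_of_mem_inertia` (a Frobenius times an inertial element is a Frobenius) and
  `mem_toricLocalKer_of_forall_mem_ordinaryAt` — if `T X` is `ordinaryAt 𝔓` for every `𝔓 ∣ v` (`res_{⟨φ⟩}(T X) = 0` for EVERY Frobenius `φ`) then
  `X ∈ toricLocalKer (K_v)` (Bertolini–Darmon's `H¹_ord`): with `A = (F − 1)E[p]` the augmentation subgroup of `D_𝔓` (AKR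
  `ToricFrob.closure_decomposition_eq_range`), `ψ(F) ∈ A` and `ψ(F i) ∈ A` for `i ∈ I_𝔓` give `ψ(I_𝔓) ⊆ A`, and every `d ∈ D_𝔓` is `Fᵏ i u` with
  `u` in the open subgroup where `ψ` vanishes and `E[p]` is fixed (tree `exists_eq_frobenius_pow_mul_of_mem_decompositionSubgroup`, Neukirch I (9.4)),
  so `ψ(D_𝔓) ⊆ A` — AKR's criterion `ToricFrob.oneCocycleClass_mem_toricLocalKer_iff` with `P = 0`.  This is the READING `ord-via-Frobenius` of
  `CastellaHsuKunduLeeLiu2025.SignedBipartiteEulerSystem` turned into a theorem (one direction).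

HONEST FRAMING: theorems only (no definition, no named fact, no `sorry`); nothing about the crux, the anchors (K1) or BSD is asserted; the signed
condition above `p` is NOT touched here (its layer-0 identification with the Kummer condition is the `±` control theorem, not in the tree).

References: [cite: Howard2006, §2.2, Lem. 2.2.1, §3.1] [cite: CastellaEtAl2025, §7.2 (arXiv:2308.10474v2 p0030 L16–L27)] [cite: GrossLMS1991, §7 (7.1)]
[cite: BertoliniDarmon2005, §2.2–§2.3] [cite: NeukirchANT1999, Ch. I §9 (9.4), Ch. II §9 (9.6)] [cite: SerreGaloisCohomology1997, I §2.4–2.5].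
-/

-- D-0017: single-problem summit, the namespace repeats the problem name by design.
set_option linter.dupNamespace false
set_option autoImplicit false

noncomputable section

open scoped Classical NumberField Pointwise

namespace Summit.BirchSwinnertonDyer.BirchSwinnertonDyer.Theorems.SignedBaseChangeAcDivAdmdefLayerZeroDictionary

open WeierstrassCurve NumberField IsDedekindDomain Field
open Literature.NumberTheory.EllipticCurves Literature.NumberTheory.GaloisRepresentations
open Literature.NumberTheory.EllipticCurves.CastellaHsuKunduLeeLiu2025
open Literature.NumberTheory.EllipticCurves.BertoliniDarmon2005
open Summit.BirchSwinnertonDyer.BirchSwinnertonDyer.Theorems.AdditiveKoly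
open Summit.BirchSwinnertonDyer.BirchSwinnertonDyer.Theorems.SignedBaseChangeAcDivAdmdefCoreRootOfSeenAnchor
open Summit.BirchSwinnertonDyer.BirchSwinnertonDyer.Theorems.SignedBaseChangeAcDivAdmdefRootZero

universe u

variable {K : Type} [Field K] [NumberField K] (W : WeierstrassCurve ℚ) [W.IsElliptic] [W.IsGloballyMinimal] {p : ℕ} [Fact p.Prime]
  (κ : ZpExtension K p)

/-! ## §1 The transport `T : H¹(K, E[p]) → H¹(Γ_{K_0}, E[p])` on cocycles; `T` is onto -/

omit [W.IsElliptic] [W.IsGloballyMinimal] in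
/-- **`T` on an explicit cocycle**: the restriction `T = resH1Hom (Γ_{K_0} ↪ Γ_K, E[(p^1:ℕ)] ↪ E[p^1])` sends `[ψ]` to the class of the
pulled-back cocycle `x ↦ ψ(x)` (coefficients respelled). [cite: SerreGaloisCohomology1997, I §2.4] -/
theorem resH1Hom_layerZero_oneCocycleClass
    (ψ : contOneCocycles (discreteTopRep (absoluteGaloisGroup K) (geomTorsion (W.baseChange K) ((p ^ 1 : ℕ) : ℤ)))) :
    resH1Hom (Literature.NumberTheory.EllipticCurves.subgroupIncl (κ.layerSubgroup 0))
        (AddSubgroup.inclusion (geomTorsion_natCast_pow_one W (K := K) (p := p)).le) (fun _ _ ↦ rfl)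
        (oneCocycleClass _ ψ) =
      oneCocycleClass (discreteTopRep (κ.layerSubgroup 0) (geomTorsion (W.baseChange K) ((p : ℤ) ^ 1)))
        (contOneCocycles.pullback (Literature.NumberTheory.EllipticCurves.subgroupIncl (κ.layerSubgroup 0))
          (resHomOfEquivariant (Literature.NumberTheory.EllipticCurves.subgroupIncl (κ.layerSubgroup 0))
            (AddSubgroup.inclusion (geomTorsion_natCast_pow_one W (K := K) (p := p)).le) (fun _ _ ↦ rfl)) ψ) := by
  change ContinuousCohomology.map _ (resHomOfEquivariant _ _ _) 1 (oneCocycleClass _ ψ) = _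
  rw [map_oneCocycleClass]

omit [W.IsElliptic] [W.IsGloballyMinimal] in
/-- **Vanishing of `res_S ∘ T` on a cocycle**: for a subgroup `S ≤ Γ_{K_0}`, `res_S (T [ψ]) = 0 ⟺ ψ|_S = ∂a` for some `a ∈ E[p]`.
[cite: SerreGaloisCohomology1997, I §2.5] -/
theorem resOfLe_resH1Hom_layerZero_eq_zero_iff {S : Subgroup (absoluteGaloisGroup K)} (hS : S ≤ κ.layerSubgroup 0)
    (ψ : contOneCocycles (discreteTopRep (absoluteGaloisGroup K) (geomTorsion (W.baseChange K) ((p ^ 1 : ℕ) : ℤ)))) :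
    resOfLe (geomTorsion (W.baseChange K) ((p : ℤ) ^ 1)) hS
        (resH1Hom (Literature.NumberTheory.EllipticCurves.subgroupIncl (κ.layerSubgroup 0))
          (AddSubgroup.inclusion (geomTorsion_natCast_pow_one W (K := K) (p := p)).le) (fun _ _ ↦ rfl)
          (oneCocycleClass _ ψ)) = 0 ↔
      ∃ a : geomTorsion (W.baseChange K) ((p ^ 1 : ℕ) : ℤ), ∀ x : S, ψ.1 x = (x : absoluteGaloisGroup K) • a - a := by
  rw [resH1Hom_layerZero_oneCocycleClass, CocycleCriteria.resOfLe_oneCocycleClass_eq_zero_iff]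
  constructor
  · rintro ⟨a, ha⟩
    refine ⟨⟨(a : (W.baseChange K).geomPoints), (geomTorsion_natCast_pow_one W (K := K) (p := p)).ge a.2⟩, fun x ↦ ?_⟩
    have h := congrArg Subtype.val (ha x)
    rw [contOneCocycles.pullback_apply] at h
    apply Subtype.ext
    exact h
  · rintro ⟨a, ha⟩
    refine ⟨⟨(a : (W.baseChange K).geomPoints), (geomTorsion_natCast_pow_one W (K := K) (p := p)).le a.2⟩, fun x ↦ ?_⟩
    rw [contOneCocycles.pullback_apply]
    apply Subtype.ext
    have h := congrArg Subtype.val (ha x)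
    exact h

omit [W.IsElliptic] [W.IsGloballyMinimal] in
/-- **`T` is onto: every class of `H¹(Γ_{K_0}, E[p])` is the restriction of a class of `H¹(K, E[p])`** (`Γ_{K_0} = κ.layerSubgroup 0 = Γ_K`; pull
the cocycle back along the inverse isomorphism `Γ_K → Γ_{K_0}`). [cite: SerreGaloisCohomology1997, I §2.4] -/
theorem exists_resH1Hom_layerZero_eq (x : (W.baseChange K).torsionH1Over ((p : ℤ) ^ 1) (κ.layerSubgroup 0)) :
    ∃ X : Vp W K p, resH1Hom (Literature.NumberTheory.EllipticCurves.subgroupIncl (κ.layerSubgroup 0))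
        (AddSubgroup.inclusion (geomTorsion_natCast_pow_one W (K := K) (p := p)).le) (fun _ _ ↦ rfl) X = x := by
  -- adapted from Theorems/…AdmdefRootZero.lean `exists_admissibleFrob_resOfLe_ne_zero` (transport to `Γ_K`)
  set M := geomTorsion (W.baseChange K) ((p : ℤ) ^ 1) with hM
  obtain ⟨b, rfl⟩ := oneCocycleClass_surjective (discreteTopRep (κ.layerSubgroup 0) M) x
  let ι : absoluteGaloisGroup K →ₜ* κ.layerSubgroup 0 :=
    { toFun := fun g ↦ ⟨g, mem_layerSubgroup_zero κ g⟩
      map_one' := rfl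
      map_mul' := fun _ _ ↦ rfl
      continuous_toFun := continuous_id.subtype_mk _ }
  have hιc : ∀ (g : absoluteGaloisGroup K) (m : M), AddMonoidHom.id M (ι g • m) = g • AddMonoidHom.id M m := fun _ _ ↦ rfl
  set ψ : contOneCocycles (discreteTopRep (absoluteGaloisGroup K) M) :=
    contOneCocycles.pullback ι (resHomOfEquivariant ι (AddMonoidHom.id M) hιc) b with hψdef
  refine ⟨oneCocycleClass _ ψ, ?_⟩
  -- the pulled-back cocycle of `ψ` along `Γ_{K_0} ↪ Γ_K` is `b` again, definitionally
  rw [resH1Hom_layerZero_oneCocycleClass]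
  congr 1

/-! ## §2 UNRAMIFIED: `unramifiedAt` at the bottom layer ⟺ `unramifiedKer` ⟺ (good `v ∤ p`) the Kummer condition -/

omit [W.IsElliptic] [W.IsGloballyMinimal] in
/-- **`T X ∈ unramifiedAt 𝔓 ⟺ X ∈ unramifiedKer 𝔓`**: both say that a cocycle of `X` restricted to the inertia group `I_𝔓` is a coboundary
(`Γ_{K_0} ∩ I_𝔓` and `I_𝔓` have the same elements). [cite: Howard2006, Def. 2.1.1, §3.1] [cite: SilvermanAEC2009, VIII.§2 Definition p. 191] -/
theorem resH1Hom_layerZero_mem_unramifiedAt_iff (𝔓 : Ideal (absIntegers (𝓞 K) K)) (X : Vp W K p) :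
    resH1Hom (Literature.NumberTheory.EllipticCurves.subgroupIncl (κ.layerSubgroup 0))
        (AddSubgroup.inclusion (geomTorsion_natCast_pow_one W (K := K) (p := p)).le) (fun _ _ ↦ rfl) X ∈
        unramifiedAt (W.baseChange K) ((p : ℤ) ^ 1) (κ.layerSubgroup 0) 𝔓 ↔
      X ∈ unramifiedKer (geomTorsion (W.baseChange K) ((p ^ 1 : ℕ) : ℤ)) 𝔓 := by
  obtain ⟨ψ, rfl⟩ := oneCocycleClass_surjective
    (discreteTopRep (absoluteGaloisGroup K) (geomTorsion (W.baseChange K) ((p ^ 1 : ℕ) : ℤ))) X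
  rw [mem_unramifiedAt_iff, resOfLe_resH1Hom_layerZero_eq_zero_iff, unramifiedKer, oneCocycleClass_mem_subgroupResKer_iff]
  constructor
  · rintro ⟨a, ha⟩
    refine ⟨a, fun τ ↦ ?_⟩
    exact ha ⟨τ, Subgroup.mem_inf.mpr ⟨mem_layerSubgroup_zero κ _, τ.2⟩⟩
  · rintro ⟨a, ha⟩
    exact ⟨a, fun x ↦ ha ⟨x, (Subgroup.mem_inf.mp x.2).2⟩⟩

omit [W.IsGloballyMinimal] in
/-- **At a GOOD place `v ∤ p`: `T X ∈ unramifiedAt 𝔓 ⟺ X` satisfies the KUMMER condition at `v`** (`selmerLocalKer (K_v)`: the class dies in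
`H¹(K_v, E)`), for any `𝔓 ∣ v` — Gross 1991 (7.1) «`E(K_λ)/pE(K_λ) ≅ H¹(𝒪_λ, E_p)`» = tree `selmerLocalKer_eq_unramifiedKer`.  This is the layer-0
dictionary «unramified = Kummer at good `v ∤ p`» between CHKLL25's and the classical Selmer conditions. [cite: GrossLMS1991, §7 (7.1), (7.4)]
[cite: CastellaEtAl2025, §7.2 (arXiv:2308.10474v2 p0030 L20–L24)] -/
theorem resH1Hom_layerZero_mem_unramifiedAt_iff_mem_selmerLocalKer {v : HeightOneSpectrum (𝓞 K)}
    (hgood : (W.baseChange K).HasGoodReductionAt v) (hpv : ((p : ℕ) : 𝓞 K) ∉ v.asIdeal)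
    {𝔓 : Ideal (absIntegers (𝓞 K) K)} (h𝔓 : 𝔓 ∈ v.primesAbove) (X : Vp W K p) :
    resH1Hom (Literature.NumberTheory.EllipticCurves.subgroupIncl (κ.layerSubgroup 0))
        (AddSubgroup.inclusion (geomTorsion_natCast_pow_one W (K := K) (p := p)).le) (fun _ _ ↦ rfl) X ∈
        unramifiedAt (W.baseChange K) ((p : ℤ) ^ 1) (κ.layerSubgroup 0) 𝔓 ↔
      X ∈ selmerLocalKer (W.baseChange K) (v.adicCompletion K) ((p ^ 1 : ℕ) : ℤ) := by
  have hn : ((((p ^ 1 : ℕ) : ℤ)) : 𝓞 K) ∉ v.asIdeal := by rw [Int.cast_natCast, Nat.pow_one]; exact hpv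
  rw [resH1Hom_layerZero_mem_unramifiedAt_iff, (W.baseChange K).selmerLocalKer_eq_unramifiedKer hgood hn h𝔓]

omit [W.IsElliptic] [W.IsGloballyMinimal] in
/-- **Unramified at `𝔓 ∣ v ∤ p` ⟹ the ordinary coordinate `res_{I_𝔓 ∩ Gal(K̄/K_∞)}` vanishes** (`I_𝔓 ∩ ker κ ⊆ Γ_{K_0} ∩ I_𝔓`).
[cite: Howard2006, §2.2, Lem. 3.1.2] -/
theorem resOfLe_inertia_eq_zero_of_mem_unramifiedAt (𝔓 : Ideal (absIntegers (𝓞 K) K))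
    {c : (W.baseChange K).torsionH1Over ((p : ℤ) ^ 1) (κ.layerSubgroup 0)}
    (hc : c ∈ unramifiedAt (W.baseChange K) ((p : ℤ) ^ 1) (κ.layerSubgroup 0) 𝔓) :
    resOfLe (geomTorsion (W.baseChange K) ((p : ℤ) ^ 1))
      (inf_le_right.trans (κ.kerSubgroup_le_layerSubgroup 0) :
        𝔓.inertia (absoluteGaloisGroup K) ⊓ κ.kerSubgroup ≤ κ.layerSubgroup 0) c = 0 := by
  rw [mem_unramifiedAt_iff] at hc
  obtain ⟨ψ, rfl⟩ := oneCocycleClass_surjective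
    (discreteTopRep (κ.layerSubgroup 0) (geomTorsion (W.baseChange K) ((p : ℤ) ^ 1))) c
  obtain ⟨a, ha⟩ := (CocycleCriteria.resOfLe_oneCocycleClass_eq_zero_iff _ ψ).mp hc
  refine (CocycleCriteria.resOfLe_oneCocycleClass_eq_zero_iff _ ψ).mpr ⟨a, fun x ↦ ?_⟩
  have hxI : (x : absoluteGaloisGroup K) ∈ 𝔓.inertia (absoluteGaloisGroup K) := (Subgroup.mem_inf.mp x.2).1
  let x' : ↥(κ.layerSubgroup 0 ⊓ 𝔓.inertia (absoluteGaloisGroup K)) :=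
    ⟨x, Subgroup.mem_inf.mpr ⟨mem_layerSubgroup_zero κ _, hxI⟩⟩
  have h1 := ha x'
  have h2 : Subgroup.inclusion (inf_le_left : κ.layerSubgroup 0 ⊓ 𝔓.inertia (absoluteGaloisGroup K) ≤ κ.layerSubgroup 0) x' =
      Subgroup.inclusion (inf_le_right.trans (κ.kerSubgroup_le_layerSubgroup 0) :
        𝔓.inertia (absoluteGaloisGroup K) ⊓ κ.kerSubgroup ≤ κ.layerSubgroup 0) x := Subtype.ext rfl
  rw [h2] at h1
  exact h1

/-! ## §3 LOCALLY TRIVIAL at a good `v ∤ p` ⟹ unramified at the chosen prime `𝔓₀` -/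

omit [W.IsGloballyMinimal] in
/-- **`loc_v X = 0 ⟹ T X` is unramified at `𝔓₀ = adicCompletionPrime K v`** for a good place `v ∤ p`: a cocycle `ψ` of `X` with
`ψ(res σ) = res σ • m − m` on `Γ_{K_v}` vanishes on `I_{𝔓₀} = res(I_{K_v})` (inertia fixes `E[p]`), so `res_{I_{𝔓₀} ∩ Gal(K̄/K_∞)} (T X) = 0`.
The genuine localisation is the tree's `galoisCohomology.localization` (restriction along `absGaloisRestrict K K_v`).
[cite: NeukirchANT1999, Ch. II §9 Prop. (9.6)] [cite: SilvermanAEC2009, Prop. VII.4.1] -/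
theorem resOfLe_inertia_resH1Hom_layerZero_eq_zero_of_localization_eq_zero {v : HeightOneSpectrum (𝓞 K)}
    (hgood : (W.baseChange K).HasGoodReductionAt v) (hpv : ((p : ℕ) : 𝓞 K) ∉ v.asIdeal) (X : Vp W K p)
    (hX : galoisCohomology.localization ((W.baseChange K).torsionGaloisModule ((p ^ 1 : ℕ) : ℤ)) (Sum.inr v) 1 X = 0) :
    resOfLe (geomTorsion (W.baseChange K) ((p : ℤ) ^ 1))
      (inf_le_right.trans (κ.kerSubgroup_le_layerSubgroup 0) :
        (adicCompletionPrime K v).inertia (absoluteGaloisGroup K) ⊓ κ.kerSubgroup ≤ κ.layerSubgroup 0)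
      (resH1Hom (Literature.NumberTheory.EllipticCurves.subgroupIncl (κ.layerSubgroup 0))
        (AddSubgroup.inclusion (geomTorsion_natCast_pow_one W (K := K) (p := p)).le) (fun _ _ ↦ rfl) X) = 0 := by
  have hn : ((((p ^ 1 : ℕ) : ℤ)) : 𝓞 K) ∉ v.asIdeal := by rw [Int.cast_natCast, Nat.pow_one]; exact hpv
  obtain ⟨ψ, rfl⟩ := oneCocycleClass_surjective
    (discreteTopRep (absoluteGaloisGroup K) (geomTorsion (W.baseChange K) ((p ^ 1 : ℕ) : ℤ))) X
  -- `loc_v [ψ] = [ψ ∘ res] = 0`: `ψ (res σ) = res σ • m - m`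
  have hX' : galoisCohomology.res ((W.baseChange K).torsionGaloisModule ((p ^ 1 : ℕ) : ℤ)) (v.adicCompletion K) 1
      (oneCocycleClass (discreteTopRep (absoluteGaloisGroup K) (geomTorsion (W.baseChange K) ((p ^ 1 : ℕ) : ℤ))) ψ) = 0 := hX
  rw [res_torsionGaloisModule_oneCocycleClass] at hX'
  obtain ⟨m, hm⟩ := (oneCocycleClass_eq_zero_iff _ _).mp hX'
  have hψres : ∀ σ : absoluteGaloisGroup (v.adicCompletion K),
      ψ.1 (absGaloisRestrict K (v.adicCompletion K) σ) = absGaloisRestrict K (v.adicCompletion K) σ • m - m := fun σ ↦ by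
    have h := hm σ
    change ψ.1 (absGaloisRestrict K (v.adicCompletion K) σ) = absGaloisRestrict K (v.adicCompletion K) σ • m - m at h
    exact h
  -- on `I_{𝔓₀} = res (I_{K_v})` the cocycle vanishes
  rw [resOfLe_resH1Hom_layerZero_eq_zero_iff]
  refine ⟨0, fun x ↦ ?_⟩
  have hxI : (x : absoluteGaloisGroup K) ∈ (adicCompletionPrime K v).inertia (absoluteGaloisGroup K) := (Subgroup.mem_inf.mp x.2).1
  have hxI' : (x : absoluteGaloisGroup K) ∈
      (absInertia (v.adicCompletion K)).map (absGaloisRestrict K (v.adicCompletion K)).toMonoidHom := by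
    rw [← inertia_adicCompletionPrime_eq_map_absInertia]; exact hxI
  obtain ⟨σ, -, hσ⟩ := hxI'
  have hσ' : absGaloisRestrict K (v.adicCompletion K) σ = (x : absoluteGaloisGroup K) := hσ
  rw [smul_zero, sub_zero, ← hσ', hψres σ, hσ',
    (W.baseChange K).smul_geomTorsion_eq_of_mem_inertia hgood hn (adicCompletionPrime_mem_primesAbove K v) hxI m, sub_self]

/-! ## §4 ORDINARY at every Frobenius ⟹ TORIC, at a Bertolini–Darmon admissible prime -/

omit [NumberField K] in
/-- **A Frobenius times an inertial element is a Frobenius**: `IsArithFrobAt F 𝔓`, `i ∈ I_𝔓` ⟹ `IsArithFrobAt (F * i) 𝔓`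
(`(F i) x − x^q = F (i x − x) + (F x − x^q)` and `F 𝔓 = 𝔓`). [cite: NeukirchANT1999, Ch. I §9 (9.4)] -/
theorem isArithFrobAt_mul_of_mem_inertia {𝔓 : Ideal (absIntegers (𝓞 K) K)} [𝔓.IsPrime] {F i : absoluteGaloisGroup K}
    (hF : IsArithFrobAt (𝓞 K) F 𝔓) (hi : i ∈ 𝔓.inertia (absoluteGaloisGroup K)) : IsArithFrobAt (𝓞 K) (F * i) 𝔓 := by
  intro x
  have h1 := hF x
  have h2 : i • x - x ∈ 𝔓 := hi x
  have hstab : F • 𝔓 = 𝔓 := hF.mem_stabilizer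
  have h3 : F • (i • x - x) ∈ 𝔓 := by
    have h := Ideal.smul_mem_pointwise_smul F _ 𝔓 h2
    rwa [hstab] at h
  have heq : (MulSemiringAction.toAlgHom (𝓞 K) (absIntegers (𝓞 K) K) (F * i)) x - x ^ Nat.card (𝓞 K ⧸ Ideal.under (𝓞 K) 𝔓) =
      F • (i • x - x) + ((MulSemiringAction.toAlgHom (𝓞 K) (absIntegers (𝓞 K) K) F) x - x ^ Nat.card (𝓞 K ⧸ Ideal.under (𝓞 K) 𝔓)) := by
    simp only [MulSemiringAction.toAlgHom_apply, mul_smul, smul_sub]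
    abel
  rw [heq]
  exact add_mem h3 h1

/-- **ORDINARY at every Frobenius ⟹ TORIC** (Bertolini–Darmon's `H¹_ord(K_q, E[p]) = im H¹(K_q, μ_p)` in the two currencies).  `q` a
Bertolini–Darmon `1`-admissible prime (only «`q ∤ pN` prime» is used), `v ∋ q`.  If the bottom-layer restriction `T X` of `X ∈ H¹(K, E[p])` is `ordinaryAt 𝔓` for every prime
`𝔓 ∣ v` of `K̄` — i.e. `res_{⟨φ⟩} (T X) = 0` for every arithmetic Frobenius `φ ∈ D_𝔓` (all of `Γ_K` lies in `Γ_{K_0}`) — then `X` satisfies the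
TORIC condition at `K_v` (`AdditiveKoly.toricLocalKer`: localisation represented by a cocycle valued in the augmentation subgroup).  Proof in the
module docstring (no hypothesis on `[K : ℚ]` is needed: only good reduction at `v ∤ p`). [cite: BertoliniDarmon2005, §2.2–§2.3, Lemma 2.6] [cite: Howard2006, Lem. 2.2.1] [cite: NeukirchANT1999, Ch. I §9 (9.4)] -/
theorem mem_toricLocalKer_of_forall_mem_ordinaryAt {q : ℕ}
    (hq : IsAdmissiblePrime (W.conductorNorm ℤ) K (fun ℓ ↦ W.frobeniusTrace ℓ) p 1 q)
    {v : HeightOneSpectrum (𝓞 K)} (hqv : ((q : ℕ) : 𝓞 K) ∈ v.asIdeal) (X : Vp W K p)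
    (hord : ∀ 𝔓 ∈ v.primesAbove,
      resH1Hom (Literature.NumberTheory.EllipticCurves.subgroupIncl (κ.layerSubgroup 0))
          (AddSubgroup.inclusion (geomTorsion_natCast_pow_one W (K := K) (p := p)).le) (fun _ _ ↦ rfl) X ∈
        ordinaryAt (W.baseChange K) ((p : ℤ) ^ 1) (κ.layerSubgroup 0) 𝔓) :
    X ∈ toricLocalKer (W.baseChange K) (v.adicCompletion K) ((p ^ 1 : ℕ) : ℤ) := by
  have hp : p.Prime := Fact.out
  have hn0 : p ^ 1 ≠ 0 := pow_ne_zero 1 hp.ne_zero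
  have hnZ : (((p ^ 1 : ℕ) : ℤ)) ≠ 0 := by exact_mod_cast hn0
  obtain ⟨hgood, hpv⟩ := hasGoodReductionAt_of_isAdmissiblePrime W K hq v hqv
  have hn : ((((p ^ 1 : ℕ) : ℤ)) : 𝓞 K) ∉ v.asIdeal := by rw [Int.cast_natCast, Nat.pow_one, ← Int.cast_natCast]; exact hpv
  obtain ⟨ψ, rfl⟩ := oneCocycleClass_surjective
    (discreteTopRep (absoluteGaloisGroup K) (geomTorsion (W.baseChange K) ((p ^ 1 : ℕ) : ℤ))) X
  -- the prime `𝔓' = 𝔓_{ι₀,𝔐}` of the toric criterion, a Frobenius `F` there, inertia fixes `E[p]`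
  haveI : CharZero (v.adicCompletion K) :=
    charZero_of_injective_algebraMap (algebraMap K (v.adicCompletion K)).injective
  obtain ⟨𝔐, h𝔐⟩ := v.localPrimesAbove_nonempty
  set 𝔓 := v.primeBelow (closureEmb (K := K) (v.adicCompletion K)) 𝔐 with h𝔓def
  have h𝔓 : 𝔓 ∈ v.primesAbove := v.primeBelow_mem_primesAbove h𝔐
  haveI : 𝔓.IsPrime := h𝔓.1
  obtain ⟨F, hF⟩ := HeightOneSpectrum.exists_isArithFrobAt_of_mem_primesAbove_holds h𝔓
  have hFD : F ∈ 𝔓.decompositionSubgroup (absoluteGaloisGroup K) := hF.mem_stabilizer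
  have hvbad : v ∉ (W.baseChange K).badPlaces (𝓞 K) := fun h ↦ h hgood
  have hI : 𝔓.inertia (absoluteGaloisGroup K) ≤ torsionFixing (W.baseChange K) (((p ^ 1 : ℕ) : ℤ)) :=
    inertia_le_torsionFixing (W.baseChange K) hvbad hn _ h𝔐
  -- the augmentation subgroup is `A = range (F − 1)`
  set g : geomTorsion (W.baseChange K) ((p ^ 1 : ℕ) : ℤ) →+ geomTorsion (W.baseChange K) ((p ^ 1 : ℕ) : ℤ) :=
    DistribSMul.toAddMonoidHom (geomTorsion (W.baseChange K) ((p ^ 1 : ℕ) : ℤ)) F - AddMonoidHom.id _ with hgdef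
  have hgapply : ∀ x, g x = F • x - x := fun _ ↦ rfl
  have hA := ToricFrob.closure_decomposition_eq_range (W.baseChange K) h𝔓 hnZ hF hI
  -- `y ∈ range g ⟺ F • y ∈ range g`
  have hFstab : ∀ y, F • y ∈ g.range ↔ y ∈ g.range := by
    intro y
    have hdiff : F • y - y ∈ g.range := ⟨y, hgapply y⟩
    constructor
    · intro h
      have : y = F • y - (F • y - y) := by abel
      rw [this]; exact sub_mem h hdiff
    · intro h
      have : F • y = (F • y - y) + y := by abel
      rw [this]; exact add_mem hdiff h
  have hFpow : ∀ (k : ℕ) (y), y ∈ g.range → F ^ k • y ∈ g.range := by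
    intro k
    induction k with
    | zero => intro y hy; rwa [pow_zero, one_smul]
    | succ k ih => intro y hy; rw [pow_succ' F k, mul_smul]; exact (hFstab _).mpr (ih y hy)
  -- ORDINARY at the Frobenius `F * i` (`i ∈ I_𝔓`): `ψ (F i) = (F i) a − a = F a − a ∈ range g`
  have hFi : ∀ i ∈ 𝔓.inertia (absoluteGaloisGroup K), ψ.1 (F * i) ∈ g.range := by
    intro i hi
    have hFi' : IsArithFrobAt (𝓞 K) (F * i) 𝔓 := isArithFrobAt_mul_of_mem_inertia hF hi
    have hFiD : F * i ∈ 𝔓.decompositionSubgroup (absoluteGaloisGroup K) := hFi'.mem_stabilizer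
    have hmem := hord 𝔓 h𝔓
    rw [mem_ordinaryAt_iff] at hmem
    have h0 := hmem (F * i) (mem_layerSubgroup_zero κ _) hFiD hFi'
    rw [resOfLe_resH1Hom_layerZero_eq_zero_iff] at h0
    obtain ⟨a, ha⟩ := h0
    have h1 := ha ⟨F * i, Subgroup.mem_zpowers _⟩
    refine ⟨a, ?_⟩
    rw [hgapply, h1, Subgroup.coe_mk, mul_smul, smul_eq_of_mem_torsionFixing (W.baseChange K) _ (hI hi) a]
  have hψF : ψ.1 F ∈ g.range := by simpa using hFi 1 (one_mem _)
  have hψI : ∀ i ∈ 𝔓.inertia (absoluteGaloisGroup K), ψ.1 i ∈ g.range := by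
    intro i hi
    have h := hFi i hi
    rw [ψ.2 F i, discreteTopRep_ρ_apply] at h
    -- `ψ F + F • ψ i ∈ range g`, `ψ F ∈ range g` ⟹ `F • ψ i ∈ range g` ⟹ `ψ i ∈ range g`
    have h2 : F • ψ.1 i ∈ g.range := by
      have : F • ψ.1 i = (ψ.1 F + F • ψ.1 i) - ψ.1 F := by abel
      rw [this]; exact sub_mem h hψF
    exact (hFstab _).mp h2
  have hψFk : ∀ k : ℕ, ψ.1 (F ^ k) ∈ g.range := by
    intro k
    induction k with
    | zero => rw [pow_zero, contOneCocycles.apply_one]; exact zero_mem _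
    | succ k ih =>
      rw [pow_succ F k, ψ.2 (F ^ k) F, discreteTopRep_ρ_apply]
      exact add_mem ih (hFpow k _ hψF)
  -- the open subgroup `U` where `ψ` vanishes and `E[p]` is fixed
  let U : Subgroup (absoluteGaloisGroup K) :=
    { carrier := {u | u ∈ torsionFixing (W.baseChange K) (((p ^ 1 : ℕ) : ℤ)) ∧ ψ.1 u = 0}
      mul_mem' := fun {a b} ha hb ↦ ⟨mul_mem ha.1 hb.1, by
        rw [ψ.2 a b, discreteTopRep_ρ_apply, ha.2, hb.2, smul_zero, add_zero]⟩
      one_mem' := ⟨one_mem _, contOneCocycles.apply_one ψ⟩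
      inv_mem' := fun {a} ha ↦ ⟨inv_mem ha.1, by
        have h := ψ.2 a⁻¹ a
        rw [inv_mul_cancel, contOneCocycles.apply_one, discreteTopRep_ρ_apply, ha.2, smul_zero, add_zero] at h
        exact h.symm⟩ }
  have hUopen : IsOpen (U : Set (absoluteGaloisGroup K)) := by
    have h1 : IsOpen (torsionFixing (W.baseChange K) (((p ^ 1 : ℕ) : ℤ)) : Set (absoluteGaloisGroup K)) :=
      isOpen_torsionFixing (W.baseChange K) hnZ
    have h2 : IsOpen (ψ.1 ⁻¹' {0}) := (isOpen_discrete _).preimage ψ.1.continuous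
    exact h1.inter h2
  -- every `d ∈ D_𝔓` is `F^k i u`, so `ψ d ∈ range g`
  have hψD : ∀ d ∈ 𝔓.decompositionSubgroup (absoluteGaloisGroup K), ψ.1 d ∈ g.range := by
    intro d hd
    obtain ⟨k, i, u, hi, hu, rfl⟩ := exists_eq_frobenius_pow_mul_of_mem_decompositionSubgroup h𝔓 hF hUopen hd
    rw [ψ.2 (F ^ k * i) u, discreteTopRep_ρ_apply, hu.2, smul_zero, add_zero, ψ.2 (F ^ k) i, discreteTopRep_ρ_apply]
    exact add_mem (hψFk k) (hFpow k _ (hψI i hi))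
  -- the toric criterion with `P = 0`
  refine (ToricFrob.oneCocycleClass_mem_toricLocalKer_iff (W.baseChange K) hn0 h𝔐 ψ).mpr ⟨0, fun d hd ↦ ?_⟩
  rw [smul_zero, sub_zero, sub_zero, hA]
  exact hψD d hd

end Summit.BirchSwinnertonDyer.BirchSwinnertonDyer.Theorems.SignedBaseChangeAcDivAdmdefLayerZeroDictionary

end
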